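import Mathlib.ModelTheory.Semantics
import Mathlib.Logic.Encodable.Basic
import Literature.ModelTheory.ProofTheory.PreSyntax

/-!
# Semantics of the untyped pre-syntax in first-order structures

Support file for the proof of the enumerability theorem
(`FirstOrder.Language.Theory.IsComputablyAxiomatizable.isRE`; Enderton, *A Mathematical
Introduction to Logic*, §2.5). Given a first-order language `L` whose symbol types
`Σ i, L.Functions i`, `Σ i, L.Relations i` are `Encodable`, a pre-term / pre-formula of
`Literature/ModelTheory/ProofTheory/PreSyntax.lean` is evaluated in a nonempty `L`-structure `M`
by *decoding* symbol codes (`Encodable.decode`), given an assignment `κ : ℕ → M` of the parameters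
and a *stack* `xs : List M` of values of the de Bruijn levels (`var i ↦ xs[i]`). Everything
ill-formed (undecodable symbol, arity mismatch, level out of range, list where a term is
expected) receives the fixed junk value `Classical.ofNonempty` (resp. `False`), which makes the
substitution lemmas below hold *without* well-formedness hypotheses.

## Main definitions

* `PreTerm.eval L κ xs t : M × List M` — value of `t` read as a term, and read as an argument list.
* `PreFormula.Realize L κ φ xs : Prop`; `all φ` at stack `xs` means `∀ a, φ.Realize (xs ++ [a])`.
* `arityF L`, `arityR L : ℕ → Option ℕ` — the arity tables of the *canonical* symbol codes
  (`n ∈ Set.range encode`), against which well-formedness `Wf` is measured.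
* `PreTerm.ofTerm`, `PreFormula.ofBounded` — translation of Mathlib syntax
  (`L.Term (Empty ⊕ Fin k)`, `L.BoundedFormula Empty k`) into pre-syntax.

## Main statements [folklore]

* `realize_liftAt`, `realize_inst`, `realize_close` — the substitution lemmas;
* `realize_congr_params` — the value depends only on the parameters that occur;
* `realize_ofBounded` — the translation is faithful:
  `(ofBounded φ).Realize L κ (List.ofFn xs) ↔ φ.Realize default xs`;
* `Wf.ofBounded`, `params_ofBounded` — translations are well formed and parameter free.

## References

* H. B. Enderton, *A Mathematical Introduction to Logic*, Academic Press (1972), §2.2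
  (satisfaction), §2.5 (substitution lemma).
-/

namespace Literature.ModelTheory.ProofTheory.PreFOL

open FirstOrder FirstOrder.Language FirstOrder.Language.Structure

variable (L : Language) [Encodable (Σ i, L.Functions i)] [Encodable (Σ i, L.Relations i)]
variable {M : Type*} [L.Structure M] [Nonempty M]

/-! ### Arity tables and evaluation -/

/-- The arity table of function-symbol codes: `arityF L f = some n` iff `f` is the *code*
`encode ⟨n, F⟩` of an `n`-ary function symbol. [folklore] -/
def arityF (f : ℕ) : Option ℕ :=
  (Encodable.decode (α := Σ i, L.Functions i) f).bind
    fun F => if Encodable.encode F = f then some F.1 else none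

/-- The arity table of relation-symbol codes. [folklore] -/
def arityR (r : ℕ) : Option ℕ :=
  (Encodable.decode (α := Σ i, L.Relations i) r).bind
    fun R => if Encodable.encode R = r then some R.1 else none

variable {L}

omit [Encodable (Σ i, L.Relations i)] in
/-- `arityF` at a code. [folklore] -/
@[simp] theorem arityF_encode {n : ℕ} (F : L.Functions n) :
    arityF L (Encodable.encode (⟨n, F⟩ : Σ i, L.Functions i)) = some n := by
  simp [arityF, Encodable.encodek]

omit [Encodable (Σ i, L.Functions i)] in
/-- `arityR` at a code. [folklore] -/
@[simp] theorem arityR_encode {n : ℕ} (R : L.Relations n) :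
    arityR L (Encodable.encode (⟨n, R⟩ : Σ i, L.Relations i)) = some n := by
  simp [arityR, Encodable.encodek]

omit [Encodable (Σ i, L.Relations i)] in
/-- Inversion of `arityF L f = some n`: `f` is the code of an `n`-ary function symbol. [folklore] -/
theorem arityF_eq_some_iff {f n : ℕ} :
    arityF L f = some n ↔ ∃ F : L.Functions n, Encodable.encode (⟨n, F⟩ : Σ i, L.Functions i) = f := by
  constructor
  · intro h
    unfold arityF at h
    cases hd : Encodable.decode (α := Σ i, L.Functions i) f with
    | none => simp [hd] at h
    | some F =>
      rw [hd, Option.bind_some] at h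
      split_ifs at h with he
      obtain ⟨m, F⟩ := F
      simp only [Option.some.injEq] at h
      subst h
      exact ⟨F, he⟩
  · rintro ⟨F, rfl⟩
    exact arityF_encode F

omit [Encodable (Σ i, L.Functions i)] in
/-- Inversion of `arityR L r = some n`. [folklore] -/
theorem arityR_eq_some_iff {r n : ℕ} :
    arityR L r = some n ↔ ∃ R : L.Relations n, Encodable.encode (⟨n, R⟩ : Σ i, L.Relations i) = r := by
  constructor
  · intro h
    unfold arityR at h
    cases hd : Encodable.decode (α := Σ i, L.Relations i) r with
    | none => simp [hd] at h
    | some R =>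
      rw [hd, Option.bind_some] at h
      split_ifs at h with he
      obtain ⟨m, R⟩ := R
      simp only [Option.some.injEq] at h
      subst h
      exact ⟨R, he⟩
  · rintro ⟨R, rfl⟩
    exact arityR_encode R

variable (L)

/-- The junk value used for everything ill-formed. [folklore] -/
noncomputable def junk (M : Type*) [Nonempty M] : M := Classical.ofNonempty

/-- Read level `i` off the stack `xs` (junk if out of range). [folklore] -/
noncomputable def env (xs : List M) (i : ℕ) : M := (xs[i]?).getD (junk M)

/-- Apply the function symbol with code `f` to a list of arguments (junk on decoding failure or
arity mismatch). [folklore] -/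
noncomputable def applyFun (f : ℕ) (l : List M) : M :=
  match Encodable.decode (α := Σ i, L.Functions i) f with
  | none => junk M
  | some F => if l.length = F.1 then funMap F.2 (fun i => env l i) else junk M

/-- Holding of the relation symbol with code `r` on a list of arguments (`False` on decoding
failure or arity mismatch). [folklore] -/
def HoldsRel (r : ℕ) (l : List M) : Prop :=
  match Encodable.decode (α := Σ i, L.Relations i) r with
  | none => False
  | some R => l.length = R.1 ∧ RelMap R.2 (fun i => env l i)

/-- Evaluation of a pre-term in `M` under the parameter assignment `κ` and the stack `xs`:
first component = value as a term, second component = value as an argument list. [folklore] -/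
noncomputable def PreTerm.eval (κ : ℕ → M) (xs : List M) : PreTerm → M × List M
  | PreTerm.var i => (env xs i, [])
  | PreTerm.param c => (κ c, [])
  | PreTerm.func f args => (applyFun L f (PreTerm.eval κ xs args).2, [])
  | PreTerm.nil => (junk M, [])
  | PreTerm.cons t rest => (junk M, (PreTerm.eval κ xs t).1 :: (PreTerm.eval κ xs rest).2)

/-- Satisfaction of a pre-formula in `M` under `κ` at the stack `xs`; `all` pushes the new level
on top of the stack. [folklore] -/
def PreFormula.Realize (κ : ℕ → M) : PreFormula → List M → Prop
  | PreFormula.falsum, _ => False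
  | PreFormula.equal t₁ t₂, xs => (t₁.eval L κ xs).1 = (t₂.eval L κ xs).1
  | PreFormula.rel r args, xs => HoldsRel L r (args.eval L κ xs).2
  | PreFormula.imp φ ψ, xs => PreFormula.Realize κ φ xs → PreFormula.Realize κ ψ xs
  | PreFormula.all φ, xs => ∀ a : M, PreFormula.Realize κ φ (xs ++ [a])

variable {L}

section env

/-- Reading a level below the split point. [folklore] -/
theorem env_append_left {xs ys : List M} {i : ℕ} (h : i < xs.length) :
    env (xs ++ ys) i = env xs i := by
  simp [env, List.getElem?_append_left h]

/-- Reading a level above the split point. [folklore] -/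
theorem env_append_right {xs ys : List M} {i : ℕ} (h : xs.length ≤ i) :
    env (xs ++ ys) i = env ys (i - xs.length) := by
  simp [env, List.getElem?_append_right h]

/-- Reading level `k` of `xs ++ a :: ys` with `xs.length = k`. [folklore] -/
theorem env_append_cons_self {xs ys : List M} {a : M} :
    env (xs ++ a :: ys) xs.length = a := by
  simp [env]

/-- Reading a level of `List.ofFn`. [folklore] -/
theorem env_ofFn {k : ℕ} (x : Fin k → M) (i : Fin k) : env (List.ofFn x) i = x i := by
  simp [env, i.2]

end env

/-! ### Closed terms have stack-independent values -/

namespace PreTerm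

omit [Encodable (Σ i, L.Relations i)]

/-- A *closed term*: a `param` or a `func` applied to a closed argument list (this excludes
variables and the bare list formers). Instantiation in the calculus is by closed terms only.
[folklore] -/
def closedTerm : PreTerm → Bool
  | param _ => true
  | func _ args => args.closed
  | _ => false

/-- A closed term is closed. [folklore] -/
theorem closed_of_closedTerm : ∀ {s : PreTerm}, s.closedTerm = true → s.closed = true
  | var _, h => by simp [closedTerm] at h
  | param _, _ => rfl
  | func _ _, h => by simpa [closedTerm, closed] using h
  | nil, h => by simp [closedTerm] at h
  | cons _ _, h => by simp [closedTerm] at h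

/-- A well-formed term at depth `0` is a closed term. [folklore] -/
theorem Wf.closedTerm_of_zero {arF : ℕ → Option ℕ} {s : PreTerm} (h : Wf arF 0 none s) :
    s.closedTerm = true := by
  cases h with
  | var hi => exact absurd hi (Nat.not_lt_zero _)
  | param c => rfl
  | func hf ha => simpa [closedTerm] using ha.closed_of_zero

/-- The value of a closed pre-term does not depend on the stack. [folklore] -/
theorem eval_of_closed (κ : ℕ → M) (xs : List M) :
    ∀ {t : PreTerm}, t.closed = true → t.eval L κ xs = t.eval L κ []
  | var _, h => by simp [closed] at h
  | param _, _ => rfl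
  | func f args, h => by
      simp only [eval]
      rw [eval_of_closed κ xs (t := args) (by simpa [closed] using h)]
  | nil, _ => rfl
  | cons t rest, h => by
      simp only [closed, Bool.and_eq_true] at h
      simp only [eval]
      rw [eval_of_closed κ xs h.1, eval_of_closed κ xs h.2]

/-- The value of a closed term is `(v, [])` at every stack, `v` its value at the empty stack.
[folklore] -/
theorem eval_of_closedTerm (κ : ℕ → M) (xs : List M) {s : PreTerm} (h : s.closedTerm = true) :
    s.eval L κ xs = ((s.eval L κ []).1, []) := by
  rw [eval_of_closed κ xs (closed_of_closedTerm h)]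
  cases s with
  | var _ => simp [closedTerm] at h
  | param _ => rfl
  | func _ _ => rfl
  | nil => simp [closedTerm] at h
  | cons _ _ => simp [closedTerm] at h

/-! ### Substitution lemmas for terms -/

/-- Lifting at the split point skips the inserted stack entry. [folklore] -/
theorem eval_liftAt (κ : ℕ → M) (xs ys : List M) (a : M) :
    ∀ t : PreTerm, (t.liftAt xs.length).eval L κ (xs ++ a :: ys) = t.eval L κ (xs ++ ys)
  | var i => by
      unfold liftAt
      by_cases h : i < xs.length
      · rw [if_pos h]
        simp only [eval, env_append_left h]
      · rw [if_neg h]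
        simp only [eval]
        rw [env_append_right (by omega), env_append_right (by omega)]
        have : i + 1 - xs.length = (i - xs.length) + 1 := by omega
        rw [this]
        simp [env]
  | param c => rfl
  | func f args => by simp only [liftAt, eval, eval_liftAt κ xs ys a args]
  | nil => rfl
  | cons t rest => by simp only [liftAt, eval, eval_liftAt κ xs ys a t, eval_liftAt κ xs ys a rest]

/-- Instantiating the level at the split point by a closed term inserts its value into the stack.
[folklore] -/
theorem eval_inst (κ : ℕ → M) (xs ys : List M) {s : PreTerm} (hs : s.closedTerm = true) :
    ∀ t : PreTerm,
      (t.inst xs.length s).eval L κ (xs ++ ys) = t.eval L κ (xs ++ (s.eval L κ []).1 :: ys)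
  | var i => by
      unfold inst
      by_cases h : i < xs.length
      · rw [if_pos h]
        simp only [eval, env_append_left h]
      · rw [if_neg h]
        by_cases he : i = xs.length
        · rw [if_pos he, eval_of_closedTerm κ _ hs]
          subst he
          simp only [eval]
          rw [env_append_cons_self]
        · rw [if_neg he]
          simp only [eval]
          rw [env_append_right (by omega), env_append_right (by omega)]
          have : i - xs.length = (i - 1 - xs.length) + 1 := by omega
          rw [this]
          simp [env]
  | param c => rfl
  | func f args => by simp only [inst, eval, eval_inst κ xs ys hs args]
  | nil => rfl
  | cons t rest => by simp only [inst, eval, eval_inst κ xs ys hs t, eval_inst κ xs ys hs rest]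

/-- Closing the levels `< k` by closed terms prepends their values to the stack. [folklore] -/
theorem eval_close (κ : ℕ → M) {k : ℕ} {σ : ℕ → PreTerm} (hσ : ∀ i < k, (σ i).closedTerm = true)
    (ys : List M) :
    ∀ t : PreTerm, (t.close k σ).eval L κ ys =
      t.eval L κ (List.ofFn (fun i : Fin k => ((σ i).eval L κ []).1) ++ ys)
  | var i => by
      unfold close
      by_cases h : i < k
      · rw [if_pos h, eval_of_closedTerm κ _ (hσ i h)]
        simp only [eval]
        rw [env_append_left (by simpa using h), env_ofFn _ ⟨i, h⟩]
      · rw [if_neg h]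
        simp only [eval]
        rw [env_append_right (by simp; omega)]
        simp
  | param c => rfl
  | func f args => by simp only [close, eval, eval_close κ hσ ys args]
  | nil => rfl
  | cons t rest => by simp only [close, eval, eval_close κ hσ ys t, eval_close κ hσ ys rest]

/-- The value of a pre-term depends only on the parameters occurring in it. [folklore] -/
theorem eval_congr_params {κ κ' : ℕ → M} (xs : List M) :
    ∀ {t : PreTerm}, (∀ c ∈ t.params, κ c = κ' c) → t.eval L κ xs = t.eval L κ' xs
  | var i, _ => rfl
  | param c, h => by simp [eval, h c (by simp [params])]
  | func f args, h => by
      simp only [eval]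
      rw [eval_congr_params xs (t := args) (fun c hc => h c (by simpa [params] using hc))]
  | nil, _ => rfl
  | cons t rest, h => by
      simp only [eval]
      rw [eval_congr_params xs (t := t) (fun c hc => h c (by simp [params, hc])),
        eval_congr_params xs (t := rest) (fun c hc => h c (by simp [params, hc]))]

end PreTerm

/-! ### Substitution lemmas for formulas -/

namespace PreFormula

/-- Weakening under an inserted level (soundness of `φ → ∀ φ↑`). [folklore] -/
theorem realize_liftAt (κ : ℕ → M) (xs : List M) (a : M) :
    ∀ (φ : PreFormula) (ys : List M),
      (φ.liftAt xs.length).Realize L κ (xs ++ a :: ys) ↔ φ.Realize L κ (xs ++ ys)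
  | falsum, ys => Iff.rfl
  | equal t₁ t₂, ys => by simp only [liftAt, Realize, PreTerm.eval_liftAt]
  | rel r args, ys => by simp only [liftAt, Realize, PreTerm.eval_liftAt]
  | imp φ ψ, ys => by
      simp only [liftAt, Realize]
      rw [realize_liftAt κ xs a φ ys, realize_liftAt κ xs a ψ ys]
  | all φ, ys => by
      simp only [liftAt, Realize]
      refine forall_congr' fun b => ?_
      have := realize_liftAt κ xs a φ (ys ++ [b])
      simpa only [List.append_assoc, List.cons_append] using this

/-- Instantiation by a closed term (soundness of `∀ φ → φ[s]`; Enderton §2.5 substitution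
lemma). [folklore] -/
theorem realize_inst (κ : ℕ → M) (xs : List M) {s : PreTerm} (hs : s.closedTerm = true) :
    ∀ (φ : PreFormula) (ys : List M),
      (φ.inst xs.length s).Realize L κ (xs ++ ys) ↔
        φ.Realize L κ (xs ++ (s.eval L κ []).1 :: ys)
  | falsum, ys => Iff.rfl
  | equal t₁ t₂, ys => by simp only [inst, Realize, PreTerm.eval_inst κ xs ys hs]
  | rel r args, ys => by simp only [inst, Realize, PreTerm.eval_inst κ xs ys hs]
  | imp φ ψ, ys => by
      simp only [inst, Realize]
      rw [realize_inst κ xs hs φ ys, realize_inst κ xs hs ψ ys]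
  | all φ, ys => by
      simp only [inst, Realize]
      refine forall_congr' fun b => ?_
      have := realize_inst κ xs hs φ (ys ++ [b])
      simpa only [List.append_assoc, List.cons_append] using this

/-- Instantiation of the outermost level of a formula at the empty stack. [folklore] -/
theorem realize_inst_zero (κ : ℕ → M) {s : PreTerm} (hs : s.closedTerm = true) (φ : PreFormula) :
    (φ.inst 0 s).Realize L κ [] ↔ φ.Realize L κ [(s.eval L κ []).1] := by
  simpa using realize_inst κ [] hs φ []

/-- Closing the levels `< k` by closed terms (the sentences of the truth lemma). [folklore] -/
theorem realize_close (κ : ℕ → M) {k : ℕ} {σ : ℕ → PreTerm}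
    (hσ : ∀ i < k, (σ i).closedTerm = true) :
    ∀ (φ : PreFormula) (ys : List M), (φ.close k σ).Realize L κ ys ↔
      φ.Realize L κ (List.ofFn (fun i : Fin k => ((σ i).eval L κ []).1) ++ ys)
  | falsum, ys => Iff.rfl
  | equal t₁ t₂, ys => by simp only [close, Realize, PreTerm.eval_close κ hσ]
  | rel r args, ys => by simp only [close, Realize, PreTerm.eval_close κ hσ]
  | imp φ ψ, ys => by
      simp only [close, Realize]
      rw [realize_close κ hσ φ ys, realize_close κ hσ ψ ys]
  | all φ, ys => by
      simp only [close, Realize]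
      refine forall_congr' fun b => ?_
      have := realize_close κ hσ φ (ys ++ [b])
      simpa only [List.append_assoc] using this

/-- Satisfaction depends only on the parameters occurring in the formula (soundness of
generalisation on a fresh constant). [folklore] -/
theorem realize_congr_params {κ κ' : ℕ → M} :
    ∀ {φ : PreFormula} (xs : List M), (∀ c ∈ φ.params, κ c = κ' c) →
      (φ.Realize L κ xs ↔ φ.Realize L κ' xs)
  | falsum, _, _ => Iff.rfl
  | equal t₁ t₂, xs, h => by
      simp only [Realize]
      rw [PreTerm.eval_congr_params xs (t := t₁) (fun c hc => h c (by simp [params, hc])),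
        PreTerm.eval_congr_params xs (t := t₂) (fun c hc => h c (by simp [params, hc]))]
  | rel r args, xs, h => by
      simp only [Realize]
      rw [PreTerm.eval_congr_params xs (t := args) (fun c hc => h c (by simpa [params] using hc))]
  | imp φ ψ, xs, h => by
      simp only [Realize]
      rw [realize_congr_params xs (φ := φ) (fun c hc => h c (by simp [params, hc])),
        realize_congr_params xs (φ := ψ) (fun c hc => h c (by simp [params, hc]))]
  | all φ, xs, h => by
      simp only [Realize]
      exact forall_congr' fun a =>
        realize_congr_params (xs ++ [a]) (φ := φ) (fun c hc => h c (by simpa [params] using hc))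

end PreFormula

/-! ### Translation of Mathlib syntax -/

namespace PreTerm

omit [Encodable (Σ i, L.Relations i)]

/-- Translation of a Mathlib term with bound variables `Fin k` (and no free variables) into a
pre-term: `var (Sum.inr i) ↦ var i`, `func F ts ↦ func (encode ⟨n, F⟩) [ts 0, …, ts (n-1)]`.
[folklore] -/
def ofTerm {k : ℕ} : L.Term (Empty ⊕ Fin k) → PreTerm
  | Term.var (Sum.inr i) => var i
  | Term.var (Sum.inl e) => e.elim
  | Term.func F ts => func (Encodable.encode (⟨_, F⟩ : Σ i, L.Functions i))
      (ofFn fun i => ofTerm (ts i))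

/-- The argument-list value of `ofFn g` is the list of term values of the `g i`. [folklore] -/
theorem eval_ofFn (κ : ℕ → M) (xs : List M) :
    ∀ {n : ℕ} (g : Fin n → PreTerm),
      ((ofFn g).eval L κ xs).2 = List.ofFn (fun i => ((g i).eval L κ xs).1)
  | 0, g => by simp [eval]
  | n + 1, g => by
      rw [ofFn_succ, List.ofFn_succ]
      simp only [eval, eval_ofFn κ xs (fun i => g i.succ)]

/-- The translation of a Mathlib term evaluates as the term. [folklore] -/
theorem eval_ofTerm (κ : ℕ → M) {k : ℕ} (x : Fin k → M) :
    ∀ t : L.Term (Empty ⊕ Fin k),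
      ((ofTerm t).eval L κ (List.ofFn x)).1 = t.realize (Sum.elim (default : Empty → M) x)
  | Term.var (Sum.inr i) => by simp [ofTerm, eval, env_ofFn]
  | Term.var (Sum.inl e) => e.elim
  | Term.func F ts => by
      simp only [ofTerm, eval, Term.realize_func]
      rw [eval_ofFn]
      simp only [applyFun, Encodable.encodek, List.length_ofFn, ↓reduceIte]
      congr 1
      funext i
      rw [env_ofFn]
      exact eval_ofTerm κ x (ts i)

/-- Translations of Mathlib terms are well formed. [folklore] -/
theorem Wf.ofTerm {k : ℕ} : ∀ t : L.Term (Empty ⊕ Fin k), Wf (arityF L) k none (ofTerm t)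
  | Term.var (Sum.inr i) => Wf.var i.2
  | Term.var (Sum.inl e) => e.elim
  | Term.func F ts => Wf.func (arityF_encode F) (Wf.ofFn fun i => Wf.ofTerm (ts i))

/-- `ofFn` of parameter-free pre-terms is parameter free. [folklore] -/
theorem params_ofFn : ∀ {n : ℕ} (g : Fin n → PreTerm), (∀ i, (g i).params = ∅) → (ofFn g).params = ∅
  | 0, _, _ => rfl
  | n + 1, g, h => by
      rw [ofFn_succ, params, h 0, params_ofFn (fun i => g i.succ) (fun i => h i.succ)]
      rfl

/-- Translations of Mathlib terms are parameter free. [folklore] -/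
theorem params_ofTerm {k : ℕ} : ∀ t : L.Term (Empty ⊕ Fin k), (ofTerm t).params = ∅
  | Term.var (Sum.inr i) => rfl
  | Term.var (Sum.inl e) => e.elim
  | Term.func F ts => by
      rw [ofTerm, params]
      exact params_ofFn _ fun i => params_ofTerm (ts i)

end PreTerm

namespace PreFormula

/-- Translation of a Mathlib bounded formula without free variables into a pre-formula
(`Fin k`-levels become `ℕ`-levels verbatim). [folklore] -/
def ofBounded : {k : ℕ} → L.BoundedFormula Empty k → PreFormula
  | _, BoundedFormula.falsum => falsum
  | _, BoundedFormula.equal t₁ t₂ => equal (PreTerm.ofTerm t₁) (PreTerm.ofTerm t₂)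
  | _, BoundedFormula.rel R ts =>
      rel (Encodable.encode (⟨_, R⟩ : Σ i, L.Relations i)) (PreTerm.ofFn fun i => PreTerm.ofTerm (ts i))
  | _, BoundedFormula.imp φ ψ => imp (ofBounded φ) (ofBounded ψ)
  | _, BoundedFormula.all φ => all (ofBounded φ)

/-- **Faithfulness of the translation**: a Mathlib bounded formula holds at `xs : Fin k → M` iff
its translation holds at the stack `List.ofFn xs` (any parameter assignment). [folklore] -/
theorem realize_ofBounded (κ : ℕ → M) :
    ∀ {k : ℕ} (φ : L.BoundedFormula Empty k) (x : Fin k → M),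
      (ofBounded φ).Realize L κ (List.ofFn x) ↔ φ.Realize (default : Empty → M) x
  | _, BoundedFormula.falsum, x => Iff.rfl
  | _, BoundedFormula.equal t₁ t₂, x => by
      simp only [ofBounded, Realize, PreTerm.eval_ofTerm, BoundedFormula.Realize]
  | _, BoundedFormula.rel R ts, x => by
      simp only [ofBounded, Realize, BoundedFormula.Realize, PreTerm.eval_ofFn, HoldsRel,
        Encodable.encodek, List.length_ofFn, true_and]
      refine iff_of_eq (congrArg _ (funext fun i => ?_))
      rw [env_ofFn]
      exact PreTerm.eval_ofTerm κ x (ts i)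
  | _, BoundedFormula.imp φ ψ, x => by
      simp only [ofBounded, Realize, BoundedFormula.Realize]
      rw [realize_ofBounded κ φ x, realize_ofBounded κ ψ x]
  | _, BoundedFormula.all φ, x => by
      simp only [ofBounded, Realize, BoundedFormula.Realize]
      refine forall_congr' fun a => ?_
      have h := realize_ofBounded κ φ (Fin.snoc x a)
      rw [List.ofFn_succ'] at h
      simpa only [List.concat_eq_append, Fin.snoc_castSucc, Fin.snoc_last] using h

/-- Faithfulness for sentences: `(ofBounded φ).Realize L κ [] ↔ M ⊨ φ`. [folklore] -/
theorem realize_ofBounded_sentence (κ : ℕ → M) (φ : L.Sentence) :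
    (ofBounded φ).Realize L κ [] ↔ M ⊨ φ := by
  have h := realize_ofBounded (M := M) κ φ (default : Fin 0 → M)
  rw [List.ofFn_zero] at h
  rw [h]
  exact Iff.rfl

/-- Translations of Mathlib bounded formulas are well formed at their depth. [folklore] -/
theorem Wf.ofBounded : ∀ {k : ℕ} (φ : L.BoundedFormula Empty k), Wf (arityF L) (arityR L) k (ofBounded φ)
  | _, BoundedFormula.falsum => Wf.falsum
  | _, BoundedFormula.equal t₁ t₂ => Wf.equal (PreTerm.Wf.ofTerm t₁) (PreTerm.Wf.ofTerm t₂)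
  | _, BoundedFormula.rel R ts =>
      Wf.rel (arityR_encode R) (PreTerm.Wf.ofFn fun i => PreTerm.Wf.ofTerm (ts i))
  | _, BoundedFormula.imp φ ψ => Wf.imp (Wf.ofBounded φ) (Wf.ofBounded ψ)
  | _, BoundedFormula.all φ => Wf.all (Wf.ofBounded φ)

/-- Translations of Mathlib bounded formulas are parameter free. [folklore] -/
theorem params_ofBounded : ∀ {k : ℕ} (φ : L.BoundedFormula Empty k), (ofBounded φ).params = ∅
  | _, BoundedFormula.falsum => rfl
  | _, BoundedFormula.equal t₁ t₂ => by simp [ofBounded, params, PreTerm.params_ofTerm]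
  | _, BoundedFormula.rel R ts => by
      rw [ofBounded, params]
      exact PreTerm.params_ofFn _ fun i => PreTerm.params_ofTerm (ts i)
  | _, BoundedFormula.imp φ ψ => by simp [ofBounded, params, params_ofBounded φ, params_ofBounded ψ]
  | _, BoundedFormula.all φ => by simpa [ofBounded, params] using params_ofBounded φ

end PreFormula

end Literature.ModelTheory.ProofTheory.PreFOL
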